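import Mathlib
import Literature.Computability.Complexity.ACC0SubsetPPoly
import Literature.Computability.Complexity.AdderBlocks
import Literature.Computability.AlgebraicComplexity.ValiantCriterion
import Summits.PneNP.PneNP.Theorems.LinAlgGateBlind.Negative.CliquePolyDetRepr

/-!
# Route ConvexRankGates — crux `LinAlgGateBlind` (stmt-PneNP-10681), support:
# the clique polynomials are a `VNP` family (Valiant's criterion, with an explicit `B₂` circuit)

Lead prover of the crux chain (line `dnf-invariant-wide-gates-see-small-cliques`, 2026-08-16). The standing
disprover's certificate `Theorems/LinAlgGateBlind/Negative/ValiantCertificate.lean` turns the crux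
`Summit.PneNP.PneNP.Theses.ConvexRankGates.LinAlgGateBlind` into superpolynomial lower bounds for the
determinantal complexity of the clique polynomials `CL_{m,k} = Σ_{|T|=k} Π_{e ⊆ T} X_e` (`Negative.cliquePoly`).
To carry that to the tree's NAMED statements of algebraic complexity (sequel file
`ConvexRankGatesLinAlgGateBlindValiantHypothesis.lean`) one needs `(CL_{n, κ n})_n ∈ VNP` for an arbitrary
clique-size schedule `κ`. This file proves it by Valiant's criterion (`isVNPFamily_circuitSum`,
`Literature/…/ValiantCriterion.lean`: a multilinear family whose `0/1` coefficient function has polynomial-size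
`B₂` circuits is p-definable), definition-free (the predicates below are local NOTATIONS, as in
`Negative/CliquePolyDetRepr.lean`):

* `isCliqueEdgeSet_iff` — a graph on `Fin m` is EXACTLY the edge set of a `k`-clique (`k ≥ 2`) iff every edge of
  `K_m` between non-isolated vertices is present and exactly `k` vertices are non-isolated;
* `cktSize_cliqueTest` — that test has `B₂` circuits with `≤ 20 (m+1)³`-ish gates (explicit bound `CliqueBound[m]`),
  assembled in the composition calculus `CktSize` (`CircuitComposition.lean`) from one unbounded OR per vertex
  (`cktSize_exists_comp`), one implication per edge, one unbounded AND (`cktSize_forall_comp`) and the one-hot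
  counting register of `ACC0SubsetPPoly.lean` (`cktSize_card_filter_eq`, exact counting over `B₂`);
* `circuitSum_eq_cliquePoly` — Valiant's Boolean sum `Σ_v [Q v]·X^v` of ANY circuit `Q` computing the test is
  `CL_{m,k}` (`k ≥ 2`; the clique monomials are indexed injectively by their vertex sets, `Negative.eq_of_liveSupp_eq`);
* `exists_isVNPFamily_cliquePoly` — hence for every schedule `κ` there is a `VNP` family over any field that
  coincides with `CL_{n, κ n}` whenever `κ n ≥ 2` (for `κ n ≤ 1` the clique polynomial is the constant `C(n, κ n)`,
  not a `0/1`-coefficient sum, and is irrelevant to the eventual statements downstream).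
-/

set_option linter.dupNamespace false  -- `Summit.PneNP.PneNP.…` is the harness-mandated namespace (summit = sub-problem)

namespace Summit.PneNP.PneNP.Theorems.LinAlgGateBlindValiant

open Finset Literature.Computability.Complexity Literature.Computability.AlgebraicComplexity MvPolynomial
open Summit.PneNP.PneNP.Theorems.LinAlgGateBlind.Negative (liveIdx liveSupp cliquePoly prod_X_eq_monomial
  eq_of_liveSupp_eq)

/- Local NOTATIONS (not declarations; hygiene is off, so their bound variables carry reserved names `eN, eC, uC, uF, TI, eI`). `NonIso[m, x, u]`: vertex `u` is non-isolated in the graph `x` on `Fin m`;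
`CliqueTest[m, k, x]`: every edge of `K_m` between non-isolated vertices of `x` is on, and exactly `k` vertices are
non-isolated; `IsCliqueEdgeSet[m, k, x]`: `x` is exactly the edge set of some `k`-clique; `Ends[m, e]`: a
(noncanonical) ordered pair of endpoints of the edge `e`; `ImpB[m, y, e]`: the implication bit of `e` read off the
wires `y = (x, non-isolation vector)`; `CliqueBound[m]`: the size bound of the clique-test circuit. -/
set_option hygiene false in
local notation "NonIso[" m ", " x ", " u "]" =>
  (∃ eN : KEdge m, u ∈ (eN : Sym2 (Fin m)) ∧ x eN = true)
set_option hygiene false in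
local notation "CliqueTest[" m ", " k ", " x "]" =>
  ((∀ eC : KEdge m, (∀ uC ∈ (eC : Sym2 (Fin m)), NonIso[m, x, uC]) → x eC = true) ∧
    (Finset.univ.filter fun uF : Fin m => NonIso[m, x, uF]).card = k)
set_option hygiene false in
local notation "IsCliqueEdgeSet[" m ", " k ", " x "]" =>
  (∃ TI : Finset (Fin m), TI.card = k ∧ ∀ eI : KEdge m, x eI = true ↔ IsLive TI eI)
set_option hygiene false in
local notation "Ends[" m ", " e "]" => (Quot.out (e : Sym2 (Fin m)) : Fin m × Fin m)
set_option hygiene false in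
local notation "ImpB[" m ", " y ", " e "]" =>
  (!(y (Sum.inr (Ends[m, e]).1) && y (Sum.inr (Ends[m, e]).2)) || y (Sum.inl e))
set_option hygiene false in
local notation "CliqueBound[" m "]" =>
  ((m * (1 + Fintype.card (KEdge m)) + (Fintype.card (KEdge m) * 2 + (1 + Fintype.card (KEdge m)))) +
    (m * (1 + Fintype.card (KEdge m)) + ((m + 1) + m * ((m + 1) * 4))) + 1)

noncomputable section

/-! ### §1 Clique edge sets, combinatorially -/

section Combinatorics

variable {m : ℕ}

/-- In the edge set of a clique on `T` (`#T ≥ 2`) the non-isolated vertices are exactly `T`. [folklore] -/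
theorem nonIso_iff_mem_of_cliqueEdges {T : Finset (Fin m)} {x : KEdge m → Bool}
    (hx : ∀ e : KEdge m, x e = true ↔ IsLive T e) (hT : 2 ≤ T.card) (u : Fin m) :
    NonIso[m, x, u] ↔ u ∈ T := by
  constructor
  · rintro ⟨e, hue, hxe⟩
    exact (hx e).1 hxe u hue
  · intro hu
    obtain ⟨w, hw, hwu⟩ := Finset.exists_mem_ne (by omega : 1 < T.card) u
    have he : s(u, w) ∈ (⊤ : SimpleGraph (Fin m)).edgeSet :=
      (SimpleGraph.mem_edgeSet ⊤).2 ((SimpleGraph.top_adj u w).2 hwu.symm)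
    exact ⟨⟨s(u, w), he⟩, by simp, (hx _).2 ((isLive_mk he).2 ⟨hu, hw⟩)⟩

/-- **Clique edge sets, combinatorially** (`k ≥ 2`): `x` is exactly the edge set of a `k`-clique iff every edge of
`K_m` between non-isolated vertices is on and exactly `k` vertices are non-isolated. [folklore] -/
theorem isCliqueEdgeSet_iff {k : ℕ} (hk : 2 ≤ k) (x : KEdge m → Bool) :
    IsCliqueEdgeSet[m, k, x] ↔ CliqueTest[m, k, x] := by
  constructor
  · rintro ⟨T, hTk, hx⟩
    have hN : ∀ u, NonIso[m, x, u] ↔ u ∈ T := nonIso_iff_mem_of_cliqueEdges hx (by omega)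
    refine ⟨fun e he => (hx e).2 fun u hu => (hN u).1 (he u hu), ?_⟩
    have : (univ.filter fun u => NonIso[m, x, u]) = T := by
      ext u; simp only [mem_filter, mem_univ, true_and]; exact hN u
    rw [this, hTk]
  · rintro ⟨hE, hcard⟩
    refine ⟨univ.filter fun u => NonIso[m, x, u], hcard, fun e => ⟨fun hxe u hu => ?_, fun hl => ?_⟩⟩
    · simp only [mem_filter, mem_univ, true_and]
      exact ⟨e, hu, hxe⟩
    · exact hE e fun u hu => by simpa using hl u hu

end Combinatorics

/-! ### §2 A polynomial-size `B₂` circuit for the clique test -/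

section CircuitConstruction

variable (m : ℕ)

/-- Stage 1: the non-isolation vector costs `m · (1 + #E)` gates (one unbounded OR per vertex,
`cktSize_exists_comp`). [folklore] -/
theorem cktSize_nonIso :
    CktSize B2 (fun (x : KEdge m → Bool) (u : Fin m) => decide NonIso[m, x, u])
      (m * (1 + Fintype.card (KEdge m))) := by
  have h := CktSize.pi_const (B := B2) (κ := Fin m)
    (f := fun (x : KEdge m → Bool) (u : Fin m) => decide NonIso[m, x, u]) (s := 1 + Fintype.card (KEdge m))
    fun u => by
    let S : Finset (KEdge m) := univ.filter fun e => u ∈ (e : Sym2 (Fin m))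
    let w : Fin S.card → KEdge m := fun a => (S.equivFin.symm a).1
    refine (cktSize_exists_comp (V := KEdge m) w).congr fun x _ => ?_
    apply Bool.decide_congr
    constructor
    · rintro ⟨a, ha⟩
      have hmem : (S.equivFin.symm a).1 ∈ S := (S.equivFin.symm a).2
      exact ⟨_, (mem_filter.1 hmem).2, ha⟩
    · rintro ⟨e, hue, hxe⟩
      refine ⟨S.equivFin ⟨e, mem_filter.2 ⟨mem_univ _, hue⟩⟩, ?_⟩
      simpa [w] using hxe
  simpa using h

/-- **Exact counting over `B₂`**: `u ↦ [#{v | u v} = k]` has circuits with at most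
`(card V + 1) + card V · 4 (card V + 1)` gates — the one-hot residue register of `ACC0SubsetPPoly.lean` modulo
`card V + 1`, read at residue `k` (constant `false` if `k > card V`). [folklore] -/
theorem cktSize_card_filter_eq (V : Type) [Fintype V] [DecidableEq V] (k : ℕ) :
    CktSize B2 (fun (u : V → Bool) (_ : Unit) => decide ((univ.filter fun v => u v = true).card = k))
      ((Fintype.card V + 1) + Fintype.card V * ((Fintype.card V + 1) * 4)) := by
  set M := Fintype.card V + 1 with hM
  haveI : NeZero M := ⟨by omega⟩
  by_cases hk : k ≤ Fintype.card V
  · have hfold := cktSize_foldState (V := V) (F := fun (_ : V) st b => shiftStep (1 : ZMod M) st b)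
      (init := oneHot 0) (fun _ => cktSize_shiftStep (1 : ZMod M)) (univ : Finset V).toList
    refine ((hfold.outMap fun _ : Unit => (Sum.inr (k : ZMod M) : V ⊕ ZMod M)).of_le ?_).congr
      fun u _ => ?_
    · simp [ZMod.card, hM]
    · simp only [Sum.elim_inr]
      rw [foldState_shift_oneHot (fun _ => (1 : ZMod M)) u, Finset.sum_map_toList, Finset.sum_boole]
      simp only [oneHot]
      have hc : (univ.filter fun v => u v = true).card < M := Nat.lt_succ_of_le (card_filter_le _ _)
      have hkM : k < M := Nat.lt_succ_of_le hk
      apply Bool.decide_congr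
      constructor
      · intro h
        have := (ZMod.natCast_eq_natCast_iff' k _ M).1 h
        rwa [Nat.mod_eq_of_lt hkM, Nat.mod_eq_of_lt hc, eq_comm] at this
      · intro h; rw [h]
  · push Not at hk
    refine ((cktSize_const V false).of_le (le_add_right (Nat.le_add_left 1 _))).congr fun u _ => ?_
    symm
    rw [decide_eq_false_iff_not]
    intro h
    have := card_filter_le (univ : Finset V) fun v => u v = true
    rw [h, card_univ] at this
    omega

/-- Membership in an edge through its chosen endpoints. [folklore] -/
theorem mem_iff_ends (e : KEdge m) (u : Fin m) : u ∈ (e : Sym2 (Fin m)) ↔ u = (Ends[m, e]).1 ∨ u = (Ends[m, e]).2 := by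
  have h : s((Ends[m, e]).1, (Ends[m, e]).2) = (e : Sym2 (Fin m)) := Quot.out_eq _
  conv_lhs => rw [← h]
  exact Sym2.mem_iff

/-- Stage 2: all implication bits `¬(N u ∧ N v) ∨ x_{uv}` cost `2 · #E` gates. [folklore] -/
theorem cktSize_impB :
    CktSize B2 (fun (y : KEdge m ⊕ Fin m → Bool) (e : KEdge m) => ImpB[m, y, e]) (Fintype.card (KEdge m) * 2) := by
  refine CktSize.pi_const fun e => ?_
  have h1 := cktSize_bin (ι := KEdge m ⊕ Fin m) (fun p q => p && q) (Sum.inr (Ends[m, e]).1)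
    (Sum.inr (Ends[m, e]).2)
  have h2 := h1.keep.andThen (fun g z => !g || z) (Sum.inr ()) (Sum.inl (Sum.inl e))
  exact (h2.outMap fun _ : Unit => Sum.inr ()).congr fun y _ => by simp

/-- Stage 3: the conjunction of the implication bits (`cktSize_forall_comp`). [folklore] -/
theorem cktSize_allImp :
    CktSize B2 (fun (y : KEdge m ⊕ Fin m → Bool) (_ : Unit) => decide (∀ e : KEdge m, ImpB[m, y, e] = true))
      (Fintype.card (KEdge m) * 2 + (1 + Fintype.card (KEdge m))) := by
  let w : Fin (Fintype.card (KEdge m)) → KEdge m := fun a => (Fintype.equivFin (KEdge m)).symm a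
  refine ((cktSize_impB m).comp (cktSize_forall_comp (V := KEdge m) w)).congr fun y _ => ?_
  apply Bool.decide_congr
  constructor
  · intro h e
    simpa [w] using h (Fintype.equivFin (KEdge m) e)
  · intro h a
    exact h _

/-- **The clique test has polynomial-size `B₂` circuits** (size `≤ CliqueBound[m]`, cubic in `m`). [folklore] -/
theorem cktSize_cliqueTest (k : ℕ) :
    CktSize B2 (fun (x : KEdge m → Bool) (_ : Unit) => decide CliqueTest[m, k, x]) CliqueBound[m] := by
  -- part A: every edge between non-isolated vertices is on
  have hA : CktSize B2 (fun (x : KEdge m → Bool) (_ : Unit) =>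
      decide (∀ e : KEdge m, (∀ u ∈ (e : Sym2 (Fin m)), NonIso[m, x, u]) → x e = true))
      (m * (1 + Fintype.card (KEdge m)) + (Fintype.card (KEdge m) * 2 + (1 + Fintype.card (KEdge m)))) := by
    refine ((cktSize_nonIso m).keep.comp (cktSize_allImp m)).congr fun x _ => ?_
    apply Bool.decide_congr
    refine forall_congr' fun e => ?_
    simp only [Sum.elim_inr, Sum.elim_inl, Bool.or_eq_true, Bool.not_eq_true', Bool.and_eq_false_iff,
      decide_eq_false_iff_not]
    constructor
    · rintro (h | h) hall
      · rcases h with h | h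
        · exact absurd (hall _ ((mem_iff_ends m e _).2 (Or.inl rfl))) h
        · exact absurd (hall _ ((mem_iff_ends m e _).2 (Or.inr rfl))) h
      · exact h
    · intro h
      by_cases h1 : NonIso[m, x, (Ends[m, e]).1]
      · by_cases h2 : NonIso[m, x, (Ends[m, e]).2]
        · refine Or.inr (h fun u hu => ?_)
          rcases (mem_iff_ends m e u).1 hu with rfl | rfl
          · exact h1
          · exact h2
        · exact Or.inl (Or.inr h2)
      · exact Or.inl (Or.inl h1)
  -- part B: exactly `k` non-isolated vertices
  have hB : CktSize B2 (fun (x : KEdge m → Bool) (_ : Unit) =>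
      decide ((univ.filter fun u => NonIso[m, x, u]).card = k))
      (m * (1 + Fintype.card (KEdge m)) + ((m + 1) + m * ((m + 1) * 4))) := by
    have h := (cktSize_nonIso m).comp (cktSize_card_filter_eq (Fin m) k)
    simp only [Fintype.card_fin] at h
    refine h.congr fun x _ => ?_
    simp
  -- conjunction
  have h := (hA.pair hB).andThen (fun a b => a && b) (Sum.inl ()) (Sum.inr ())
  refine (h.outMap fun _ : Unit => Sum.inr ()).congr fun x _ => ?_
  simp only [Sum.elim_inr, Sum.elim_inl, Bool.decide_and]

/-- `#E(K_m) ≤ m²` in the `KEdge` spelling (`CliqueLPGate.nE_le`). [folklore] -/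
theorem card_KEdge_le : Fintype.card (KEdge m) ≤ m ^ 2 := CliqueLPGate.nE_le m

/-- A crude closed form: `CliqueBound[m] ≤ 20 (m + 1)³`. [folklore] -/
theorem cliqueBound_le : CliqueBound[m] ≤ 20 * (m + 1) ^ 3 := by
  have hE := card_KEdge_le m
  set E := Fintype.card (KEdge m)
  have h1 : E ≤ (m + 1) ^ 2 := hE.trans (Nat.pow_le_pow_left (Nat.le_succ m) 2)
  have hm : m ≤ m + 1 := Nat.le_succ m
  have hm1 : 1 ≤ m + 1 := Nat.succ_pos m
  have hcube : (m + 1) ^ 3 = (m + 1) * (m + 1) ^ 2 := by ring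
  have hsq : (m + 1) ^ 2 = (m + 1) * (m + 1) := by ring
  nlinarith [Nat.zero_le m, Nat.zero_le E]

/-- **A `B₂` circuit of size `≤ 20 (m+1)³` recognising the edge sets of `k`-cliques** (`k ≥ 2`), on the edge variables
enumerated by `CliqueLPGate.eE`. [folklore] -/
theorem exists_circuit_cliqueEdgeSet {k : ℕ} (hk : 2 ≤ k) :
    ∃ C : Circuit (Fin (CliqueLPGate.nE m)), C.IsOver B2 ∧ C.size ≤ 20 * (m + 1) ^ 3 ∧
      ∀ v, C.eval v = decide IsCliqueEdgeSet[m, k, fun e : KEdge m => v (CliqueLPGate.eE m e)] := by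
  obtain ⟨C, hC, hs, he⟩ :=
    (((cktSize_cliqueTest m k).of_le (cliqueBound_le m)).rewire fun e : KEdge m => CliqueLPGate.eE m e).toCircuit
  refine ⟨C, hC, hs, fun v => ?_⟩
  rw [he v]
  exact Bool.decide_congr (isCliqueEdgeSet_iff hk _).symm

end CircuitConstruction

/-! ### §3 Valiant's Boolean sum of the clique test is the clique polynomial -/

section BoolSum

variable {m : ℕ} (F : Type) [Field F]

/-- The on-positions of the live-edge indicator of `T` are `liveIdx m T`. [folklore] -/
theorem liveIdx_eq_filter (T : Finset (Fin m)) :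
    liveIdx m T = univ.filter fun i => decide (IsLive T ((CliqueLPGate.eE m).symm i)) = true := by
  ext i; simp [liveIdx]

/-- The selector monomial of the live-edge indicator of `T` is the clique monomial of `T`. [folklore] -/
theorem prod_ite_liveVec (T : Finset (Fin m)) :
    (∏ t : Fin (CliqueLPGate.nE m),
        (if decide (IsLive T ((CliqueLPGate.eE m).symm t)) then (X t : MvPolynomial (Fin (CliqueLPGate.nE m)) F) else 1)) =
      monomial (liveSupp m T) 1 := by
  rw [← Finset.prod_filter, ← liveIdx_eq_filter, liveSupp, prod_X_eq_monomial]

/-- Live-edge indicators of `k`-sets are injective (`k ≥ 2`). [folklore] -/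
theorem liveVec_injOn {k : ℕ} (hk : 2 ≤ k) :
    Set.InjOn (fun (T : Finset (Fin m)) (i : Fin (CliqueLPGate.nE m)) => decide (IsLive T ((CliqueLPGate.eE m).symm i)))
      (powersetCard k (univ : Finset (Fin m)) : Set (Finset (Fin m))) := by
  intro T hT T' hT' h
  rw [mem_coe, mem_powersetCard] at hT hT'
  have hi : ∀ i, decide (IsLive T ((CliqueLPGate.eE m).symm i)) = decide (IsLive T' ((CliqueLPGate.eE m).symm i)) :=
    fun i => congrFun h i
  have hidx : liveIdx m T = liveIdx m T' := by
    rw [liveIdx_eq_filter, liveIdx_eq_filter]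
    exact filter_congr fun i _ => by rw [hi i]
  apply eq_of_liveSupp_eq (m := m) (by omega) (by omega)
  rw [liveSupp, liveSupp, hidx]

/-- The accepted inputs of the clique-edge-set indicator are the live-edge indicators of the `k`-sets. [folklore] -/
theorem filter_isCliqueEdgeSet (k : ℕ) :
    (univ.filter fun v : Fin (CliqueLPGate.nE m) → Bool =>
        decide IsCliqueEdgeSet[m, k, fun e : KEdge m => v (CliqueLPGate.eE m e)] = true) =
      (powersetCard k (univ : Finset (Fin m))).image
        fun (T : Finset (Fin m)) (i : Fin (CliqueLPGate.nE m)) => decide (IsLive T ((CliqueLPGate.eE m).symm i)) := by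
  ext v
  simp only [mem_filter, mem_univ, true_and, mem_image, mem_powersetCard, subset_univ, decide_eq_true_eq]
  constructor
  · rintro ⟨T, hT, hx⟩
    refine ⟨T, hT, funext fun i => ?_⟩
    have := hx ((CliqueLPGate.eE m).symm i)
    simp only [Equiv.apply_symm_apply] at this
    rcases hvi : v i with _ | _
    · simpa [hvi] using this
    · simpa [hvi] using this
  · rintro ⟨T, hT, rfl⟩
    exact ⟨T, hT, fun e => by simp⟩

/-- **Valiant's Boolean sum of the clique-edge-set indicator is `CL_{m,k}`** (`k ≥ 2`): for ANY circuit `Q` computing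
the indicator, `Σ_v [Q v] · Π_{v_t = 1} X_t = Σ_{|T| = k} X^{E(K_T)}`. [folklore] -/
theorem circuitSum_eq_cliquePoly {k : ℕ} (hk : 2 ≤ k) (Q : Circuit (Fin (CliqueLPGate.nE m)))
    (hQ : ∀ v, Q.eval v = decide IsCliqueEdgeSet[m, k, fun e : KEdge m => v (CliqueLPGate.eE m e)]) :
    ValiantCriterion.circuitSum (k := F) Q = cliquePoly m F k := by
  unfold ValiantCriterion.circuitSum cliquePoly
  have step : ∀ v : Fin (CliqueLPGate.nE m) → Bool,
      C (CircuitArith.toK F (Q.eval v)) * ∏ t, (if v t then (X t : MvPolynomial _ F) else 1) =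
        if decide IsCliqueEdgeSet[m, k, fun e : KEdge m => v (CliqueLPGate.eE m e)] = true then
          ∏ t, (if v t then (X t : MvPolynomial _ F) else 1) else 0 := by
    intro v
    rw [hQ v]
    cases decide IsCliqueEdgeSet[m, k, fun e : KEdge m => v (CliqueLPGate.eE m e)] <;> simp [CircuitArith.toK]
  simp_rw [step]
  rw [← Finset.sum_filter, filter_isCliqueEdgeSet, Finset.sum_image (liveVec_injOn hk)]
  exact Finset.sum_congr rfl fun T _ => prod_ite_liveVec F T

end BoolSum

/-! ### §4 The clique family is in `VNP` -/

section VNP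

/-- **The clique polynomials form a `VNP` family, for every clique-size schedule `κ`** (Valiant's criterion
`isVNPFamily_circuitSum` applied to the circuits of `exists_circuit_cliqueEdgeSet`; at the finitely relevant indices with
`κ n ≤ 1` the family is SOME Valiant Boolean sum, not the constant `CL_{n, κ n} = C(n, κ n)`). [folklore] -/
theorem exists_isVNPFamily_cliquePoly : ∀ (F : Type) [Field F] (κ : ℕ → ℕ), ∃ g : (n : ℕ) → MvPolynomial (Fin (Literature.Computability.Complexity.CliqueLPGate.nE n)) F, Literature.Computability.AlgebraicComplexity.IsVNPFamily (σ := fun n => Fin (Literature.Computability.Complexity.CliqueLPGate.nE n)) g ∧ ∀ n, 2 ≤ κ n → g n = Summit.PneNP.PneNP.Theorems.LinAlgGateBlind.Negative.cliquePoly n F (κ n) := by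
  intro F _ κ
  classical
  -- a circuit for every index: the clique-edge-set indicator when `κ n ≥ 2`, a constant otherwise
  have hQ : ∀ n, ∃ C : Circuit (Fin (CliqueLPGate.nE n)), C.IsOver B2 ∧ C.size ≤ 20 * (n + 1) ^ 3 ∧
      (2 ≤ κ n → ∀ v, C.eval v = decide IsCliqueEdgeSet[n, κ n, fun e : KEdge n => v (CliqueLPGate.eE n e)]) := by
    intro n
    by_cases hn : 2 ≤ κ n
    · obtain ⟨C, hC, hs, he⟩ := exists_circuit_cliqueEdgeSet n hn
      exact ⟨C, hC, hs, fun _ => he⟩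
    · obtain ⟨C, hC, hs, -⟩ := (cktSize_const (Fin (CliqueLPGate.nE n)) false).toCircuit
      exact ⟨C, hC, hs.trans (by nlinarith [Nat.zero_le n, pow_pos (Nat.succ_pos n) 3]), fun h => absurd h hn⟩
  choose Q hQover hQsize hQeval using hQ
  refine ⟨fun n => ValiantCriterion.circuitSum (k := F) (Q n), ?_, fun n hn => ?_⟩
  · refine isVNPFamily_circuitSum (k := F) (m := CliqueLPGate.nE)
      ((IsPBounded.pow_holds IsPBounded.id 2).mono fun n => CliqueLPGate.nE_le n) Q hQover ?_
    refine (IsPBounded.mul_holds (IsPBounded.const 20)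
      (IsPBounded.pow_holds (IsPBounded.add_holds IsPBounded.id (IsPBounded.const 1)) 3)).mono fun n => ?_
    exact hQsize n
  · exact circuitSum_eq_cliquePoly F hn (Q n) (hQeval n hn)

end VNP

end

end Summit.PneNP.PneNP.Theorems.LinAlgGateBlindValiant
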